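import Summits.PneNP.PneNP.Theorems.MacroscopicTwinsAbove.Negative.DefectBound

/-!
# `MacroscopicTwinsAbove` (stmt-PneNP-2720, route PneNP/PhaseTwins) — negative side IV: no uniform `δ`; twins cannot be sparse

Standing-adversary (cdisprove, cycle 2) lemmas for `Summit.PneNP.PneNP.Theses.PhaseTwins.MacroscopicTwinsAbove`,
continuing `Negative/DefectBound.lean` (notation `Z`, `lamC`, `HomIndist`, `Witness`). The crux is NOT refuted.
* `lamC_le_div`: the typed threshold decays like `1/Δ` — `λ_c(Δ) ≤ 8/(Δ-2)` for `Δ ≥ 3`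
  (`λ_c(Δ) = (1/(Δ-2))·(1+1/(Δ-2))^{Δ-1}` and `(1+1/d)^{d+1} ≤ e^{(d+1)/d} ≤ e² < 8`).
* `not_uniformDelta`: the natural strengthening "ONE `δ > 0` serves every `Δ ≥ 3` and every `λ > λ_c(Δ)`" is FALSE:
  every witness has `δ ≤ log(1+λ) ≤ λ` (`delta_le_log`), and admissible activities go to `0` as `Δ → ∞`; so the
  crux's `δ(Δ, λ)` necessarily degenerates in the large-degree / small-activity corner (quantitatively
  `δ(Δ, λ) ≤ log(1 + λ)`, and `λ` may be as small as `8/(Δ-2)`).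
* `defect_bound_edges`: the edge form of the defect bound of `DefectBound.lean` —
  `δ n ≤ 2(|E(G)| + |E(H)|) log(1+λ)` (twins agree off their non-isolated vertices): witnesses need linearly many
  edges, total average degree `≥ δ/(2 log(1+λ))`.
(The degree-redundancy lemma `maxDegree_le_of_homIndist` of the same cycle lives in `Negative/StarDegree.lean`.)
Refuter seat cdisprove-stmt-PneNP-2720-g2, 2026-08-16; commentary in
`Summits/PneNP/PneNP/Cruxes/MacroscopicTwinsAbove/Disproof.lean`.
-/

set_option linter.dupNamespace false

namespace Summit.PneNP.PneNP.Theorems.MacroscopicTwinsAbove.Negative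

open scoped Classical BigOperators
open Finset

/-! ### The threshold decays like `1/Δ`; no uniform `δ` -/

/-- `e² < 8`. [folklore] -/
theorem exp_two_lt_eight : Real.exp 2 < 8 := by
  have h1 := Real.exp_one_lt_d9
  have h : Real.exp 2 = Real.exp 1 ^ 2 := by
    rw [← Real.exp_nat_mul]; norm_num
  rw [h]
  nlinarith [Real.exp_pos 1]

/-- `(1 + 1/d)^{d+1} ≤ 8` for `d ≥ 1` (via `1 + x ≤ eˣ` and `e² < 8`). [folklore] -/
theorem one_add_inv_pow_le {d : ℕ} (hd : 1 ≤ d) : (1 + 1 / (d : ℝ)) ^ (d + 1) ≤ 8 := by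
  have hd0 : (0 : ℝ) < d := by exact_mod_cast (show 0 < d by omega)
  have h3 : (1 + 1 / (d : ℝ)) ≤ Real.exp (1 / d) := by
    have := Real.add_one_le_exp (1 / (d : ℝ)); linarith
  have h4 : (1 + 1 / (d : ℝ)) ^ (d + 1) ≤ Real.exp (1 / d) ^ (d + 1) :=
    pow_le_pow_left₀ (by positivity) h3 _
  have h5 : Real.exp (1 / (d : ℝ)) ^ (d + 1) = Real.exp (((d + 1 : ℕ) : ℝ) * (1 / d)) := by
    rw [← Real.exp_nat_mul]
  have h6 : ((d + 1 : ℕ) : ℝ) * (1 / d) ≤ 2 := by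
    have hd1 : (1 : ℝ) ≤ d := by exact_mod_cast hd
    rw [mul_one_div, div_le_iff₀ hd0]
    push_cast
    linarith
  calc (1 + 1 / (d : ℝ)) ^ (d + 1) ≤ Real.exp (1 / d) ^ (d + 1) := h4
    _ = Real.exp (((d + 1 : ℕ) : ℝ) * (1 / d)) := h5
    _ ≤ Real.exp 2 := Real.exp_le_exp.2 h6
    _ ≤ 8 := exp_two_lt_eight.le

/-- **The typed threshold decays like `1/Δ`:** `λ_c(Δ) ≤ 8/(Δ-2)` for `Δ ≥ 3`
(indeed `λ_c(Δ) = (1/(Δ-2))·(1+1/(Δ-2))^{Δ-1} ~ e/Δ`). [folklore] -/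
theorem lamC_le_div {Δ : ℕ} (hΔ : 3 ≤ Δ) : lamC Δ ≤ 8 / ((Δ : ℝ) - 2) := by
  obtain ⟨d, rfl⟩ : ∃ d, Δ = d + 2 := ⟨Δ - 2, by omega⟩
  have hd : 1 ≤ d := by omega
  have hd0 : (0 : ℝ) < d := by exact_mod_cast (show 0 < d by omega)
  unfold lamC
  have e1 : ((d + 2 : ℕ) : ℝ) - 1 = d + 1 := by push_cast; ring
  have e2 : ((d + 2 : ℕ) : ℝ) - 2 = d := by push_cast; ring
  have e3 : d + 2 - 1 = d + 1 := by omega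
  rw [e1, e2, e3]
  have key : ((d : ℝ) + 1) ^ (d + 1) ≤ 8 * (d : ℝ) ^ (d + 1) := by
    have h1 : (d : ℝ) + 1 = d * (1 + 1 / d) := by field_simp
    calc ((d : ℝ) + 1) ^ (d + 1) = (d : ℝ) ^ (d + 1) * (1 + 1 / d) ^ (d + 1) := by
          rw [h1, mul_pow]
      _ ≤ (d : ℝ) ^ (d + 1) * 8 := by
          gcongr
          exact one_add_inv_pow_le hd
      _ = 8 * (d : ℝ) ^ (d + 1) := by ring
  rw [div_le_div_iff₀ (by positivity) hd0]
  calc ((d : ℝ) + 1) ^ (d + 1) * d ≤ 8 * (d : ℝ) ^ (d + 1) * d := by gcongr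
    _ = 8 * (d : ℝ) ^ (d + 2) := by ring

/-- **No uniform density gap.** The strengthening of the crux in which ONE `δ > 0` serves every `Δ ≥ 3` and every
`λ > λ_c(Δ)` is FALSE: `δ ≤ log(1 + λ) ≤ λ` for every witness (`delta_le_log`) while `λ_c(Δ) ≤ 8/(Δ-2) → 0`, so at
`Δ = d + 2` with `d > 9/δ` and `λ = 9/d > λ_c(Δ)` no witness exists even at depth `k = 0`. The crux's `δ` must depend
on `(Δ, λ)`. [folklore] -/
theorem not_uniformDelta :
    ¬ ∃ δ : ℝ, 0 < δ ∧ ∀ Δ : ℕ, 3 ≤ Δ → ∀ lam : ℝ, lamC Δ < lam → ∀ k : ℕ,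
      ∃ (n : ℕ) (G H : SimpleGraph (Fin n)), Witness Δ lam δ k n G H := by
  rintro ⟨δ, hδ, h⟩
  obtain ⟨d, hd⟩ : ∃ d : ℕ, 9 / δ < d := exists_nat_gt _
  have hdpos : (0 : ℝ) < d := lt_trans (by positivity) hd
  have hΔ : 3 ≤ d + 2 := by
    have : 0 < d := by exact_mod_cast hdpos
    omega
  have hcast : ((d + 2 : ℕ) : ℝ) - 2 = d := by push_cast; ring
  have hlamC : lamC (d + 2) < 9 / d := by
    calc lamC (d + 2) ≤ 8 / (((d + 2 : ℕ) : ℝ) - 2) := lamC_le_div hΔ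
      _ = 8 / d := by rw [hcast]
      _ < 9 / d := by gcongr; norm_num
  obtain ⟨n, G, H, hn, -, -, -, hgap⟩ := h (d + 2) hΔ (9 / d) hlamC 0
  have hlam : (0 : ℝ) ≤ 9 / d := by positivity
  have h1 : δ ≤ Real.log (1 + 9 / d) := delta_le_log hn hlam hgap
  have h2 : Real.log (1 + 9 / d) ≤ 9 / d := by
    have := Real.log_le_sub_one_of_pos (show (0 : ℝ) < 1 + 9 / d by positivity)
    linarith
  have h3 : 9 / (d : ℝ) < δ := by
    rw [div_lt_iff₀ hdpos]
    rw [div_lt_iff₀ hδ] at hd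
    linarith
  linarith

/-! ### Twins cannot be sparse: the edge form of the defect bound -/

/-- At most `2e` vertices of a graph with `e` edges have positive degree (`Σ_v deg v = 2e`). [folklore] -/
theorem card_posDegree_le_twice_edges {n : ℕ} (G : SimpleGraph (Fin n)) :
    (Finset.univ.filter fun v : Fin n => 0 < G.degree v).card ≤ 2 * G.edgeFinset.card := by
  rw [← SimpleGraph.sum_degrees_eq_twice_card_edges]
  calc (Finset.univ.filter fun v : Fin n => 0 < G.degree v).card
      = ∑ v ∈ Finset.univ.filter (fun v : Fin n => 0 < G.degree v), 1 := by simp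
    _ ≤ ∑ v ∈ Finset.univ.filter (fun v : Fin n => 0 < G.degree v), G.degree v :=
        Finset.sum_le_sum fun v hv => (Finset.mem_filter.1 hv).2
    _ ≤ ∑ v, G.degree v :=
        Finset.sum_le_sum_of_subset_of_nonneg (Finset.filter_subset _ _) fun _ _ _ => Nat.zero_le _

/-- **Edge form of the defect bound.** Twins with gap `e^{δn}` agree off the set of non-isolated vertices, so
`δ · n ≤ 2 (|E(G)| + |E(H)|) · log(1+λ)` (`defect_bound` with `S` = vertices of positive degree in `G` or `H`):
a witness family needs linearly many edges — total average degree `≥ δ / (2 log(1+λ))`; sparse twins are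
impossible. [folklore] -/
theorem defect_bound_edges {n : ℕ} {G H : SimpleGraph (Fin n)} {lam δ : ℝ} (hlam : 0 ≤ lam)
    (hgap : Real.exp (δ * n) * Z H lam ≤ Z G lam) :
    δ * n ≤ 2 * ((G.edgeFinset.card : ℝ) + H.edgeFinset.card) * Real.log (1 + lam) := by
  set S : Finset (Fin n) := Finset.univ.filter (fun v : Fin n => 0 < G.degree v ∨ 0 < H.degree v) with hS
  have hagree : ∀ u v, u ∉ S → v ∉ S → (G.Adj u v ↔ H.Adj u v) := by
    intro u v hu _
    have hu' : G.degree u = 0 ∧ H.degree u = 0 := by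
      simp only [hS, Finset.mem_filter, Finset.mem_univ, true_and, not_or, not_lt, Nat.le_zero] at hu
      exact hu
    constructor
    · intro h
      have := (G.degree_pos_iff_exists_adj u).2 ⟨v, h⟩
      omega
    · intro h
      have := (H.degree_pos_iff_exists_adj u).2 ⟨v, h⟩
      omega
  have h1 := defect_bound hagree hlam hgap
  have hScard : S.card ≤ 2 * G.edgeFinset.card + 2 * H.edgeFinset.card := by
    have hsplit : S = (Finset.univ.filter fun v : Fin n => 0 < G.degree v) ∪
        (Finset.univ.filter fun v : Fin n => 0 < H.degree v) := by
      rw [hS, ← Finset.filter_or]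
    rw [hsplit]
    exact (Finset.card_union_le _ _).trans
      (Nat.add_le_add (card_posDegree_le_twice_edges G) (card_posDegree_le_twice_edges H))
  have hlog : 0 ≤ Real.log (1 + lam) := Real.log_nonneg (by linarith)
  have hScard' : (S.card : ℝ) ≤ 2 * ((G.edgeFinset.card : ℝ) + H.edgeFinset.card) := by
    have : ((S.card : ℕ) : ℝ) ≤ ((2 * G.edgeFinset.card + 2 * H.edgeFinset.card : ℕ) : ℝ) := by
      exact_mod_cast hScard
    push_cast at this
    linarith
  calc δ * n ≤ S.card * Real.log (1 + lam) := h1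
    _ ≤ 2 * ((G.edgeFinset.card : ℝ) + H.edgeFinset.card) * Real.log (1 + lam) :=
        mul_le_mul_of_nonneg_right hScard' hlog

end Summit.PneNP.PneNP.Theorems.MacroscopicTwinsAbove.Negative
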